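import Summits.BirchSwinnertonDyer.Rank1Residual.Additive.X3ThreeLineDatum
import Summits.BirchSwinnertonDyer.Rank1Residual.X2.CellAGVParCertificatesN9A
import Mathlib.Tactic.Simproc.Factors
import HarnessLib

/-!
# X3♯(G-ord, `e = 2`) at `p = 3`: kernel records of the per-pair LINE DATUM `X3LineDatumThree W` for the
# Case-1 members of the B-X3G booking list — part L of 16 (cell `bsd-addord`, seat
# `bsd-addord-twist`, strategy = twist transport)

HONEST FRAMING (cell `bsd-addord`, `run/shared/lean/pub/bsd-addord/README.md` §4): the programme's
target of record is the full Birch–Swinnerton-Dyer formula for every `E/ℚ` of analytic rank `≤ 1`.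
DATA-RECORDS module: theorems only (no definition, no named fact, no `sorry`); it BOOKS NOTHING and
moves no mark — booking is the planner's act (TARGET.md v5.5 §8 protocol B-X3G, (iv)).

## What is recorded

For each isogeny class `(N, class, 3)` of the booking list `HOME/bsd-addord-twist-booking-members.tsv`
(kit job j242057; the r_an = 0, non-CM, non-degenerate branch-parity classes of cell (G-ord, `e = 2`) at
`p = 3` in census v2, planner keys `HOME/planner/bx3g/`), the CASE-1 MEMBER `W = [a₁, a₂, a₃, a₄, a₆]`
(Cremona's globally minimal model; the first member in Cremona order carrying the EVEN rational `3`-line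
as a SUB-line) and the theorem `X3LineDatumThree W` — SOME rational `3`-line `Φ₀ ≤ W[3]` which is even,
has non-trivial `Γ_ℚ`-action and `χ_{−3}`-twist ramified at `3` — proved by
`x3LineDatumThree_of_cert_of_delta` from the certificate `(x₀, s, D, q)`: `Ψ₃(x₀) = 0`, `D` squarefree,
`s ≠ 0`, `D·s² = Ψ₂Sq(x₀)`, `0 < D`, `D ≠ 1`, `3 ∤ D` (`norm_num` identities, one prime-factor-list
computation with X2a's helper `squarefree_of_nodup_primeFactorsList_natAbs`, `decide`s). This is the per-pair line-datum input of
`ClassX3Gord.{{missingLowerBoundAt,bsdp}}_three_rankZero_of_facts_of_nonAnomalous`; the class binders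
(`ClassX3Gord W 3`, `¬ HasCM`, `analyticRank = 0`, `ReductionNonAnomalous W 3`) are data of record
(Cremona / the planner's two-engine census), NOT kernel statements here; the other members of each class
are reached by Cassels (`N10.bsdp_of_isIsogenous_of_bsdp`, binder `bsdRHS_eq_of_isIsogenous`). The
docstring of each record names the class, the anomalous bit of the twist `V = W ⊗ χ_{−3}` and `D`
(`φ = χ_D`). Records sorted by conductor.

References: [GreenbergVatsal2000] §2 p. 28 (the line `Φ`); lane file
`HOME/bsd-addord-twist-booking-members.tsv`; `Additive/X3ThreeLineDatum.lean`.
-/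

set_option autoImplicit false

open WeierstrassCurve Polynomial Literature.NumberTheory.EllipticCurves
  Literature.NumberTheory.EllipticCurves.Rank1Residual

namespace Summit.BirchSwinnertonDyer.Rank1Residual.Additive.X3ThreeLineDatumRecords

/-- `333900d2` = `[0,0,0,359131200,2095253700500]` (class `333900d`, (G-ord, `e = 2`) at `3`; twist `37100a2`, `a₃(V) = -1`, non-anomalous; even line
`φ = χ_{5}`): `x₀ = 3840`, `D = 5`, `s = 1680700`, `Ψ₂Sq(x₀) = 14123762450000` ⇒ `X3LineDatumThree W`. [folklore] -/
theorem x3LineDatumThree_333900d2 : X3LineDatumThree (⟨0, 0, 0, 359131200, 2095253700500⟩ : WeierstrassCurve ℚ) :=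
  x3LineDatumThree_of_cert_of_delta _ (by norm_num [Δ, b₂, b₄, b₆, b₈]) 3840 1680700 5
    (by simp only [Ψ₃, eval_add, eval_mul, eval_pow, eval_C, eval_X, eval_ofNat]; norm_num [b₂, b₄, b₆, b₈])
    (X2.CellACertN9.squarefree_of_nodup_primeFactorsList_natAbs (by norm_num) (by simp [Nat.primeFactorsList_ofNat])) (by norm_num)
    (by rw [KernelDisc.eval_Ψ₂Sq]; norm_num [b₂, b₄, b₆]) (by decide) (by decide) (by decide)

/-- `334620ch3` = `[0,0,0,-677352,211863301]` (class `334620ch`, (G-ord, `e = 2`) at `3`; twist `37180d3`, `a₃(V) = -2` — ANOMALOUS (outside the end state as typed); even line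
`φ = χ_{13}`): `x₀ = 624`, `D = 13`, `s = 3146`, `Ψ₂Sq(x₀) = 128665108` ⇒ `X3LineDatumThree W`. [folklore] -/
theorem x3LineDatumThree_334620ch3 : X3LineDatumThree (⟨0, 0, 0, -677352, 211863301⟩ : WeierstrassCurve ℚ) :=
  x3LineDatumThree_of_cert_of_delta _ (by norm_num [Δ, b₂, b₄, b₆, b₈]) 624 3146 13
    (by simp only [Ψ₃, eval_add, eval_mul, eval_pow, eval_C, eval_X, eval_ofNat]; norm_num [b₂, b₄, b₆, b₈])
    (X2.CellACertN9.squarefree_of_nodup_primeFactorsList_natAbs (by norm_num) (by simp [Nat.primeFactorsList_ofNat])) (by norm_num)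
    (by rw [KernelDisc.eval_Ψ₂Sq]; norm_num [b₂, b₄, b₆]) (by decide) (by decide) (by decide)

/-- `337050m2` = `[1,-1,0,174258,18573916]` (class `337050m`, (G-ord, `e = 2`) at `3`; twist `37450l2`, `a₃(V) = 2`, non-anomalous; even line
`φ = χ_{5}`): `x₀ = 94`, `D = 5`, `s = 5350`, `Ψ₂Sq(x₀) = 143112500` ⇒ `X3LineDatumThree W`. [folklore] -/
theorem x3LineDatumThree_337050m2 : X3LineDatumThree (⟨1, -1, 0, 174258, 18573916⟩ : WeierstrassCurve ℚ) :=
  x3LineDatumThree_of_cert_of_delta _ (by norm_num [Δ, b₂, b₄, b₆, b₈]) 94 5350 5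
    (by simp only [Ψ₃, eval_add, eval_mul, eval_pow, eval_C, eval_X, eval_ofNat]; norm_num [b₂, b₄, b₆, b₈])
    (X2.CellACertN9.squarefree_of_nodup_primeFactorsList_natAbs (by norm_num) (by simp [Nat.primeFactorsList_ofNat])) (by norm_num)
    (by rw [KernelDisc.eval_Ψ₂Sq]; norm_num [b₂, b₄, b₆]) (by decide) (by decide) (by decide)

/-- `338130co2` = `[1,-1,1,39448012,-50001828969]` (class `338130co`, (G-ord, `e = 2`) at `3`; twist `37570e2`, `a₃(V) = 2`, non-anomalous; even line
`φ = χ_{17}`): `x₀ = 3685`, `D = 17`, `s = 184960`, `Ψ₂Sq(x₀) = 581573427200` ⇒ `X3LineDatumThree W`. [folklore] -/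
theorem x3LineDatumThree_338130co2 : X3LineDatumThree (⟨1, -1, 1, 39448012, -50001828969⟩ : WeierstrassCurve ℚ) :=
  x3LineDatumThree_of_cert_of_delta _ (by norm_num [Δ, b₂, b₄, b₆, b₈]) 3685 184960 17
    (by simp only [Ψ₃, eval_add, eval_mul, eval_pow, eval_C, eval_X, eval_ofNat]; norm_num [b₂, b₄, b₆, b₈])
    (X2.CellACertN9.squarefree_of_nodup_primeFactorsList_natAbs (by norm_num) (by simp [Nat.primeFactorsList_ofNat])) (by norm_num)
    (by rw [KernelDisc.eval_Ψ₂Sq]; norm_num [b₂, b₄, b₆]) (by decide) (by decide) (by decide)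

/-- `339300a2` = `[0,0,0,-414649200,3249895236500]` (class `339300a`, (G-ord, `e = 2`) at `3`; twist `37700a2`, `a₃(V) = -1`, non-anomalous; even line
`φ = χ_{5}`): `x₀ = 11760`, `D = 5`, `s = 580`, `Ψ₂Sq(x₀) = 1682000` ⇒ `X3LineDatumThree W`. [folklore] -/
theorem x3LineDatumThree_339300a2 : X3LineDatumThree (⟨0, 0, 0, -414649200, 3249895236500⟩ : WeierstrassCurve ℚ) :=
  x3LineDatumThree_of_cert_of_delta _ (by norm_num [Δ, b₂, b₄, b₆, b₈]) 11760 580 5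
    (by simp only [Ψ₃, eval_add, eval_mul, eval_pow, eval_C, eval_X, eval_ofNat]; norm_num [b₂, b₄, b₆, b₈])
    (X2.CellACertN9.squarefree_of_nodup_primeFactorsList_natAbs (by norm_num) (by simp [Nat.primeFactorsList_ofNat])) (by norm_num)
    (by rw [KernelDisc.eval_Ψ₂Sq]; norm_num [b₂, b₄, b₆]) (by decide) (by decide) (by decide)

/-- `342720qb2` = `[0,0,0,-3206892,2210427056]` (class `342720qb`, (G-ord, `e = 2`) at `3`; twist `38080k2`, `a₃(V) = -1`, non-anomalous; even line
`φ = χ_{2}`): `x₀ = 1014`, `D = 2`, `s = 1568`, `Ψ₂Sq(x₀) = 4917248` ⇒ `X3LineDatumThree W`. [folklore] -/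
theorem x3LineDatumThree_342720qb2 : X3LineDatumThree (⟨0, 0, 0, -3206892, 2210427056⟩ : WeierstrassCurve ℚ) :=
  x3LineDatumThree_of_cert_of_delta _ (by norm_num [Δ, b₂, b₄, b₆, b₈]) 1014 1568 2
    (by simp only [Ψ₃, eval_add, eval_mul, eval_pow, eval_C, eval_X, eval_ofNat]; norm_num [b₂, b₄, b₆, b₈])
    Int.prime_two.squarefree (by norm_num)
    (by rw [KernelDisc.eval_Ψ₂Sq]; norm_num [b₂, b₄, b₆]) (by decide) (by decide) (by decide)

/-- `345150db3` = `[1,-1,1,3495370,1426580997]` (class `345150db`, (G-ord, `e = 2`) at `3`; twist `38350a3`, `a₃(V) = 2`, non-anomalous; even line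
`φ = χ_{5}`): `x₀ = 454`, `D = 5`, `s = 49855`, `Ψ₂Sq(x₀) = 12427605125` ⇒ `X3LineDatumThree W`. [folklore] -/
theorem x3LineDatumThree_345150db3 : X3LineDatumThree (⟨1, -1, 1, 3495370, 1426580997⟩ : WeierstrassCurve ℚ) :=
  x3LineDatumThree_of_cert_of_delta _ (by norm_num [Δ, b₂, b₄, b₆, b₈]) 454 49855 5
    (by simp only [Ψ₃, eval_add, eval_mul, eval_pow, eval_C, eval_X, eval_ofNat]; norm_num [b₂, b₄, b₆, b₈])
    (X2.CellACertN9.squarefree_of_nodup_primeFactorsList_natAbs (by norm_num) (by simp [Nat.primeFactorsList_ofNat])) (by norm_num)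
    (by rw [KernelDisc.eval_Ψ₂Sq]; norm_num [b₂, b₄, b₆]) (by decide) (by decide) (by decide)

/-- `347850bo2` = `[1,-1,0,-1091817,192443341]` (class `347850bo`, (G-ord, `e = 2`) at `3`; twist `38650u2`, `a₃(V) = -1`, non-anomalous; even line
`φ = χ_{5}`): `x₀ = 1354`, `D = 5`, `s = 30920`, `Ψ₂Sq(x₀) = 4780232000` ⇒ `X3LineDatumThree W`. [folklore] -/
theorem x3LineDatumThree_347850bo2 : X3LineDatumThree (⟨1, -1, 0, -1091817, 192443341⟩ : WeierstrassCurve ℚ) :=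
  x3LineDatumThree_of_cert_of_delta _ (by norm_num [Δ, b₂, b₄, b₆, b₈]) 1354 30920 5
    (by simp only [Ψ₃, eval_add, eval_mul, eval_pow, eval_C, eval_X, eval_ofNat]; norm_num [b₂, b₄, b₆, b₈])
    (X2.CellACertN9.squarefree_of_nodup_primeFactorsList_natAbs (by norm_num) (by simp [Nat.primeFactorsList_ofNat])) (by norm_num)
    (by rw [KernelDisc.eval_Ψ₂Sq]; norm_num [b₂, b₄, b₆]) (by decide) (by decide) (by decide)

/-- `348075be2` = `[0,0,1,-2305267410,42602008969786]` (class `348075be`, (G-ord, `e = 2`) at `3`; twist `38675c2`, `a₃(V) = -1`, non-anomalous; even line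
`φ = χ_{5}`): `x₀ = 27735`, `D = 5`, `s = 3757`, `Ψ₂Sq(x₀) = 70575245` ⇒ `X3LineDatumThree W`. [folklore] -/
theorem x3LineDatumThree_348075be2 : X3LineDatumThree (⟨0, 0, 1, -2305267410, 42602008969786⟩ : WeierstrassCurve ℚ) :=
  x3LineDatumThree_of_cert_of_delta _ (by norm_num [Δ, b₂, b₄, b₆, b₈]) 27735 3757 5
    (by simp only [Ψ₃, eval_add, eval_mul, eval_pow, eval_C, eval_X, eval_ofNat]; norm_num [b₂, b₄, b₆, b₈])
    (X2.CellACertN9.squarefree_of_nodup_primeFactorsList_natAbs (by norm_num) (by simp [Nat.primeFactorsList_ofNat])) (by norm_num)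
    (by rw [KernelDisc.eval_Ψ₂Sq]; norm_num [b₂, b₄, b₆]) (by decide) (by decide) (by decide)

/-- `348174bc2` = `[1,-1,1,-1028165549,12689714607477]` (class `348174bc`, (G-ord, `e = 2`) at `3`; twist `38686b2`, `a₃(V) = 2`, non-anomalous; even line
`φ = χ_{29}`): `x₀ = 18292`, `D = 29`, `s = 19343`, `Ψ₂Sq(x₀) = 10850397821` ⇒ `X3LineDatumThree W`. [folklore] -/
theorem x3LineDatumThree_348174bc2 : X3LineDatumThree (⟨1, -1, 1, -1028165549, 12689714607477⟩ : WeierstrassCurve ℚ) :=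
  x3LineDatumThree_of_cert_of_delta _ (by norm_num [Δ, b₂, b₄, b₆, b₈]) 18292 19343 29
    (by simp only [Ψ₃, eval_add, eval_mul, eval_pow, eval_C, eval_X, eval_ofNat]; norm_num [b₂, b₄, b₆, b₈])
    (X2.CellACertN9.squarefree_of_nodup_primeFactorsList_natAbs (by norm_num) (by simp [Nat.primeFactorsList_ofNat])) (by norm_num)
    (by rw [KernelDisc.eval_Ψ₂Sq]; norm_num [b₂, b₄, b₆]) (by decide) (by decide) (by decide)

/-- `348480dp2` = `[0,0,0,625812,473772112]` (class `348480dp`, (G-ord, `e = 2`) at `3`; twist `38720df2`, `a₃(V) = 1` — ANOMALOUS (outside the end state as typed); even line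
`φ = χ_{22}`): `x₀ = 66`, `D = 22`, `s = 9680`, `Ψ₂Sq(x₀) = 2061452800` ⇒ `X3LineDatumThree W`. [folklore] -/
theorem x3LineDatumThree_348480dp2 : X3LineDatumThree (⟨0, 0, 0, 625812, 473772112⟩ : WeierstrassCurve ℚ) :=
  x3LineDatumThree_of_cert_of_delta _ (by norm_num [Δ, b₂, b₄, b₆, b₈]) 66 9680 22
    (by simp only [Ψ₃, eval_add, eval_mul, eval_pow, eval_C, eval_X, eval_ofNat]; norm_num [b₂, b₄, b₆, b₈])
    (X2.CellACertN9.squarefree_of_nodup_primeFactorsList_natAbs (by norm_num) (by simp [Nat.primeFactorsList_ofNat])) (by norm_num)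
    (by rw [KernelDisc.eval_Ψ₂Sq]; norm_num [b₂, b₄, b₆]) (by decide) (by decide) (by decide)

/-- `348480dq2` = `[0,0,0,-15708,758032]` (class `348480dq`, (G-ord, `e = 2`) at `3`; twist `38720de2`, `a₃(V) = 1` — ANOMALOUS (outside the end state as typed); even line
`φ = χ_{22}`): `x₀ = 66`, `D = 22`, `s = 40`, `Ψ₂Sq(x₀) = 35200` ⇒ `X3LineDatumThree W`. [folklore] -/
theorem x3LineDatumThree_348480dq2 : X3LineDatumThree (⟨0, 0, 0, -15708, 758032⟩ : WeierstrassCurve ℚ) :=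
  x3LineDatumThree_of_cert_of_delta _ (by norm_num [Δ, b₂, b₄, b₆, b₈]) 66 40 22
    (by simp only [Ψ₃, eval_add, eval_mul, eval_pow, eval_C, eval_X, eval_ofNat]; norm_num [b₂, b₄, b₆, b₈])
    (X2.CellACertN9.squarefree_of_nodup_primeFactorsList_natAbs (by norm_num) (by simp [Nat.primeFactorsList_ofNat])) (by norm_num)
    (by rw [KernelDisc.eval_Ψ₂Sq]; norm_num [b₂, b₄, b₆]) (by decide) (by decide) (by decide)

/-- `348480gs3` = `[0,0,0,-180048,29399128]` (class `348480gs`, (G-ord, `e = 2`) at `3`; twist `38720dn3`, `a₃(V) = -2` — ANOMALOUS (outside the end state as typed); even line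
`φ = χ_{22}`): `x₀ = 264`, `D = 22`, `s = 220`, `Ψ₂Sq(x₀) = 1064800` ⇒ `X3LineDatumThree W`. [folklore] -/
theorem x3LineDatumThree_348480gs3 : X3LineDatumThree (⟨0, 0, 0, -180048, 29399128⟩ : WeierstrassCurve ℚ) :=
  x3LineDatumThree_of_cert_of_delta _ (by norm_num [Δ, b₂, b₄, b₆, b₈]) 264 220 22
    (by simp only [Ψ₃, eval_add, eval_mul, eval_pow, eval_C, eval_X, eval_ofNat]; norm_num [b₂, b₄, b₆, b₈])
    (X2.CellACertN9.squarefree_of_nodup_primeFactorsList_natAbs (by norm_num) (by simp [Nat.primeFactorsList_ofNat])) (by norm_num)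
    (by rw [KernelDisc.eval_Ψ₂Sq]; norm_num [b₂, b₄, b₆]) (by decide) (by decide) (by decide)

/-- `348480iw2` = `[0,0,0,20663412,-30866358512]` (class `348480iw`, (G-ord, `e = 2`) at `3`; twist `38720dj2`, `a₃(V) = 1` — ANOMALOUS (outside the end state as typed); even line
`φ = χ_{22}`): `x₀ = 3234`, `D = 22`, `s = 112640`, `Ψ₂Sq(x₀) = 279130931200` ⇒ `X3LineDatumThree W`. [folklore] -/
theorem x3LineDatumThree_348480iw2 : X3LineDatumThree (⟨0, 0, 0, 20663412, -30866358512⟩ : WeierstrassCurve ℚ) :=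
  x3LineDatumThree_of_cert_of_delta _ (by norm_num [Δ, b₂, b₄, b₆, b₈]) 3234 112640 22
    (by simp only [Ψ₃, eval_add, eval_mul, eval_pow, eval_C, eval_X, eval_ofNat]; norm_num [b₂, b₄, b₆, b₈])
    (X2.CellACertN9.squarefree_of_nodup_primeFactorsList_natAbs (by norm_num) (by simp [Nat.primeFactorsList_ofNat])) (by norm_num)
    (by rw [KernelDisc.eval_Ψ₂Sq]; norm_num [b₂, b₄, b₆]) (by decide) (by decide) (by decide)

/-- `348480mf2` = `[0,0,0,1392468,-378567376]` (class `348480mf`, (G-ord, `e = 2`) at `3`; twist `38720o2`, `a₃(V) = -1`, non-anomalous; even line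
`φ = χ_{2}`): `x₀ = 726`, `D = 2`, `s = 45056`, `Ψ₂Sq(x₀) = 4060086272` ⇒ `X3LineDatumThree W`. [folklore] -/
theorem x3LineDatumThree_348480mf2 : X3LineDatumThree (⟨0, 0, 0, 1392468, -378567376⟩ : WeierstrassCurve ℚ) :=
  x3LineDatumThree_of_cert_of_delta _ (by norm_num [Δ, b₂, b₄, b₆, b₈]) 726 45056 2
    (by simp only [Ψ₃, eval_add, eval_mul, eval_pow, eval_C, eval_X, eval_ofNat]; norm_num [b₂, b₄, b₆, b₈])
    Int.prime_two.squarefree (by norm_num)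
    (by rw [KernelDisc.eval_Ψ₂Sq]; norm_num [b₂, b₄, b₆]) (by decide) (by decide) (by decide)

/-- `349830ce2` = `[1,-1,0,-840384,135321408]` (class `349830ce`, (G-ord, `e = 2`) at `3`; twist `38870y2`, `a₃(V) = 1` — ANOMALOUS (outside the end state as typed); even line
`φ = χ_{13}`): `x₀ = 1180`, `D = 13`, `s = 15548`, `Ψ₂Sq(x₀) = 3142623952` ⇒ `X3LineDatumThree W`. [folklore] -/
theorem x3LineDatumThree_349830ce2 : X3LineDatumThree (⟨1, -1, 0, -840384, 135321408⟩ : WeierstrassCurve ℚ) :=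
  x3LineDatumThree_of_cert_of_delta _ (by norm_num [Δ, b₂, b₄, b₆, b₈]) 1180 15548 13
    (by simp only [Ψ₃, eval_add, eval_mul, eval_pow, eval_C, eval_X, eval_ofNat]; norm_num [b₂, b₄, b₆, b₈])
    (X2.CellACertN9.squarefree_of_nodup_primeFactorsList_natAbs (by norm_num) (by simp [Nat.primeFactorsList_ofNat])) (by norm_num)
    (by rw [KernelDisc.eval_Ψ₂Sq]; norm_num [b₂, b₄, b₆]) (by decide) (by decide) (by decide)

/-- `349830dn2` = `[1,-1,1,-3218468,2057849057]` (class `349830dn`, (G-ord, `e = 2`) at `3`; twist `38870o2`, `a₃(V) = -2` — ANOMALOUS (outside the end state as typed); even line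
`φ = χ_{13}`): `x₀ = 1648`, `D = 13`, `s = 19435`, `Ψ₂Sq(x₀) = 4910349925` ⇒ `X3LineDatumThree W`. [folklore] -/
theorem x3LineDatumThree_349830dn2 : X3LineDatumThree (⟨1, -1, 1, -3218468, 2057849057⟩ : WeierstrassCurve ℚ) :=
  x3LineDatumThree_of_cert_of_delta _ (by norm_num [Δ, b₂, b₄, b₆, b₈]) 1648 19435 13
    (by simp only [Ψ₃, eval_add, eval_mul, eval_pow, eval_C, eval_X, eval_ofNat]; norm_num [b₂, b₄, b₆, b₈])
    (X2.CellACertN9.squarefree_of_nodup_primeFactorsList_natAbs (by norm_num) (by simp [Nat.primeFactorsList_ofNat])) (by norm_num)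
    (by rw [KernelDisc.eval_Ψ₂Sq]; norm_num [b₂, b₄, b₆]) (by decide) (by decide) (by decide)

/-- `350550eq3` = `[1,-1,1,-9041627255,330918447935247]` (class `350550eq`, (G-ord, `e = 2`) at `3`; twist `38950k3`, `a₃(V) = 2`, non-anomalous; even line
`φ = χ_{5}`): `x₀ = 54904`, `D = 5`, `s = 1805`, `Ψ₂Sq(x₀) = 16290125` ⇒ `X3LineDatumThree W`. [folklore] -/
theorem x3LineDatumThree_350550eq3 : X3LineDatumThree (⟨1, -1, 1, -9041627255, 330918447935247⟩ : WeierstrassCurve ℚ) :=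
  x3LineDatumThree_of_cert_of_delta _ (by norm_num [Δ, b₂, b₄, b₆, b₈]) 54904 1805 5
    (by simp only [Ψ₃, eval_add, eval_mul, eval_pow, eval_C, eval_X, eval_ofNat]; norm_num [b₂, b₄, b₆, b₈])
    (X2.CellACertN9.squarefree_of_nodup_primeFactorsList_natAbs (by norm_num) (by simp [Nat.primeFactorsList_ofNat])) (by norm_num)
    (by rw [KernelDisc.eval_Ψ₂Sq]; norm_num [b₂, b₄, b₆]) (by decide) (by decide) (by decide)

/-- `351450dh2` = `[1,-1,1,-3342605,2330908647]` (class `351450dh`, (G-ord, `e = 2`) at `3`; twist `39050d2`, `a₃(V) = -1`, non-anomalous; even line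
`φ = χ_{5}`): `x₀ = 1354`, `D = 5`, `s = 15125`, `Ψ₂Sq(x₀) = 1143828125` ⇒ `X3LineDatumThree W`. [folklore] -/
theorem x3LineDatumThree_351450dh2 : X3LineDatumThree (⟨1, -1, 1, -3342605, 2330908647⟩ : WeierstrassCurve ℚ) :=
  x3LineDatumThree_of_cert_of_delta _ (by norm_num [Δ, b₂, b₄, b₆, b₈]) 1354 15125 5
    (by simp only [Ψ₃, eval_add, eval_mul, eval_pow, eval_C, eval_X, eval_ofNat]; norm_num [b₂, b₄, b₆, b₈])
    (X2.CellACertN9.squarefree_of_nodup_primeFactorsList_natAbs (by norm_num) (by simp [Nat.primeFactorsList_ofNat])) (by norm_num)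
    (by rw [KernelDisc.eval_Ψ₂Sq]; norm_num [b₂, b₄, b₆]) (by decide) (by decide) (by decide)

/-- `355950dy3` = `[1,-1,1,-128753522105,17781125808807897]` (class `355950dy`, (G-ord, `e = 2`) at `3`; twist `39550b3`, `a₃(V) = 2`, non-anomalous; even line
`φ = χ_{5}`): `x₀ = 217804`, `D = 5`, `s = 7503125`, `Ψ₂Sq(x₀) = 281484423828125` ⇒ `X3LineDatumThree W`. [folklore] -/
theorem x3LineDatumThree_355950dy3 : X3LineDatumThree (⟨1, -1, 1, -128753522105, 17781125808807897⟩ : WeierstrassCurve ℚ) :=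
  x3LineDatumThree_of_cert_of_delta _ (by norm_num [Δ, b₂, b₄, b₆, b₈]) 217804 7503125 5
    (by simp only [Ψ₃, eval_add, eval_mul, eval_pow, eval_C, eval_X, eval_ofNat]; norm_num [b₂, b₄, b₆, b₈])
    (X2.CellACertN9.squarefree_of_nodup_primeFactorsList_natAbs (by norm_num) (by simp [Nat.primeFactorsList_ofNat])) (by norm_num)
    (by rw [KernelDisc.eval_Ψ₂Sq]; norm_num [b₂, b₄, b₆]) (by decide) (by decide) (by decide)

/-- `356850cm2` = `[1,-1,1,-17271680,27632527197]` (class `356850cm`, (G-ord, `e = 2`) at `3`; twist `39650b2`, `a₃(V) = -1`, non-anomalous; even line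
`φ = χ_{5}`): `x₀ = 2344`, `D = 5`, `s = 4225`, `Ψ₂Sq(x₀) = 89253125` ⇒ `X3LineDatumThree W`. [folklore] -/
theorem x3LineDatumThree_356850cm2 : X3LineDatumThree (⟨1, -1, 1, -17271680, 27632527197⟩ : WeierstrassCurve ℚ) :=
  x3LineDatumThree_of_cert_of_delta _ (by norm_num [Δ, b₂, b₄, b₆, b₈]) 2344 4225 5
    (by simp only [Ψ₃, eval_add, eval_mul, eval_pow, eval_C, eval_X, eval_ofNat]; norm_num [b₂, b₄, b₆, b₈])
    (X2.CellACertN9.squarefree_of_nodup_primeFactorsList_natAbs (by norm_num) (by simp [Nat.primeFactorsList_ofNat])) (by norm_num)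
    (by rw [KernelDisc.eval_Ψ₂Sq]; norm_num [b₂, b₄, b₆]) (by decide) (by decide) (by decide)

/-- `359550ei3` = `[1,-1,1,-1101605,26969738397]` (class `359550ei`, (G-ord, `e = 2`) at `3`; twist `39950e3`, `a₃(V) = 2`, non-anomalous; even line
`φ = χ_{5}`): `x₀ = 4`, `D = 5`, `s = 146875`, `Ψ₂Sq(x₀) = 107861328125` ⇒ `X3LineDatumThree W`. [folklore] -/
theorem x3LineDatumThree_359550ei3 : X3LineDatumThree (⟨1, -1, 1, -1101605, 26969738397⟩ : WeierstrassCurve ℚ) :=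
  x3LineDatumThree_of_cert_of_delta _ (by norm_num [Δ, b₂, b₄, b₆, b₈]) 4 146875 5
    (by simp only [Ψ₃, eval_add, eval_mul, eval_pow, eval_C, eval_X, eval_ofNat]; norm_num [b₂, b₄, b₆, b₈])
    (X2.CellACertN9.squarefree_of_nodup_primeFactorsList_natAbs (by norm_num) (by simp [Nat.primeFactorsList_ofNat])) (by norm_num)
    (by rw [KernelDisc.eval_Ψ₂Sq]; norm_num [b₂, b₄, b₆]) (by decide) (by decide) (by decide)

/-- `361350cd2` = `[1,-1,0,-2232,115456]` (class `361350cd`, (G-ord, `e = 2`) at `3`; twist `40150x2`, `a₃(V) = -1`, non-anomalous; even line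
`φ = χ_{5}`): `x₀ = 4`, `D = 5`, `s = 292`, `Ψ₂Sq(x₀) = 426320` ⇒ `X3LineDatumThree W`. [folklore] -/
theorem x3LineDatumThree_361350cd2 : X3LineDatumThree (⟨1, -1, 0, -2232, 115456⟩ : WeierstrassCurve ℚ) :=
  x3LineDatumThree_of_cert_of_delta _ (by norm_num [Δ, b₂, b₄, b₆, b₈]) 4 292 5
    (by simp only [Ψ₃, eval_add, eval_mul, eval_pow, eval_C, eval_X, eval_ofNat]; norm_num [b₂, b₄, b₆, b₈])
    (X2.CellACertN9.squarefree_of_nodup_primeFactorsList_natAbs (by norm_num) (by simp [Nat.primeFactorsList_ofNat])) (by norm_num)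
    (by rw [KernelDisc.eval_Ψ₂Sq]; norm_num [b₂, b₄, b₆]) (by decide) (by decide) (by decide)

/-- `361350ce2` = `[1,-1,0,-47206287,-233743671059]` (class `361350ce`, (G-ord, `e = 2`) at `3`; twist `40150y2`, `a₃(V) = -1`, non-anomalous; even line
`φ = χ_{5}`): `x₀ = 13054`, `D = 5`, `s = 1048576`, `Ψ₂Sq(x₀) = 5497558138880` ⇒ `X3LineDatumThree W`. [folklore] -/
theorem x3LineDatumThree_361350ce2 : X3LineDatumThree (⟨1, -1, 0, -47206287, -233743671059⟩ : WeierstrassCurve ℚ) :=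
  x3LineDatumThree_of_cert_of_delta _ (by norm_num [Δ, b₂, b₄, b₆, b₈]) 13054 1048576 5
    (by simp only [Ψ₃, eval_add, eval_mul, eval_pow, eval_C, eval_X, eval_ofNat]; norm_num [b₂, b₄, b₆, b₈])
    (X2.CellACertN9.squarefree_of_nodup_primeFactorsList_natAbs (by norm_num) (by simp [Nat.primeFactorsList_ofNat])) (by norm_num)
    (by rw [KernelDisc.eval_Ψ₂Sq]; norm_num [b₂, b₄, b₆]) (by decide) (by decide) (by decide)

/-- `361998dz2` = `[1,-1,1,138379,-490805467]` (class `361998dz`, (G-ord, `e = 2`) at `3`; twist `40222c2`, `a₃(V) = -2` — ANOMALOUS (outside the end state as typed); even line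
`φ = χ_{13}`): `x₀ = 1180`, `D = 13`, `s = 20111`, `Ψ₂Sq(x₀) = 5257880173` ⇒ `X3LineDatumThree W`. [folklore] -/
theorem x3LineDatumThree_361998dz2 : X3LineDatumThree (⟨1, -1, 1, 138379, -490805467⟩ : WeierstrassCurve ℚ) :=
  x3LineDatumThree_of_cert_of_delta _ (by norm_num [Δ, b₂, b₄, b₆, b₈]) 1180 20111 13
    (by simp only [Ψ₃, eval_add, eval_mul, eval_pow, eval_C, eval_X, eval_ofNat]; norm_num [b₂, b₄, b₆, b₈])
    (X2.CellACertN9.squarefree_of_nodup_primeFactorsList_natAbs (by norm_num) (by simp [Nat.primeFactorsList_ofNat])) (by norm_num)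
    (by rw [KernelDisc.eval_Ψ₂Sq]; norm_num [b₂, b₄, b₆]) (by decide) (by decide) (by decide)

/-- `363888ce3` = `[0,0,0,232845,72581938]` (class `363888ce`, (G-ord, `e = 2`) at `3`; twist `40432r3`, `a₃(V) = -2` — ANOMALOUS (outside the end state as typed); even line
`φ = χ_{19}`): `x₀ = 57`, `D = 19`, `s = 4256`, `Ψ₂Sq(x₀) = 344157184` ⇒ `X3LineDatumThree W`. [folklore] -/
theorem x3LineDatumThree_363888ce3 : X3LineDatumThree (⟨0, 0, 0, 232845, 72581938⟩ : WeierstrassCurve ℚ) :=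
  x3LineDatumThree_of_cert_of_delta _ (by norm_num [Δ, b₂, b₄, b₆, b₈]) 57 4256 19
    (by simp only [Ψ₃, eval_add, eval_mul, eval_pow, eval_C, eval_X, eval_ofNat]; norm_num [b₂, b₄, b₆, b₈])
    (X2.CellACertN9.squarefree_of_nodup_primeFactorsList_natAbs (by norm_num) (by simp [Nat.primeFactorsList_ofNat])) (by norm_num)
    (by rw [KernelDisc.eval_Ψ₂Sq]; norm_num [b₂, b₄, b₆]) (by decide) (by decide) (by decide)

/-- `363888eo2` = `[0,0,0,-4161,97603]` (class `363888eo`, (G-ord, `e = 2`) at `3`; twist `40432q2`, `a₃(V) = 1` — ANOMALOUS (outside the end state as typed); even line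
`φ = χ_{19}`): `x₀ = 57`, `D = 19`, `s = 98`, `Ψ₂Sq(x₀) = 182476` ⇒ `X3LineDatumThree W`. [folklore] -/
theorem x3LineDatumThree_363888eo2 : X3LineDatumThree (⟨0, 0, 0, -4161, 97603⟩ : WeierstrassCurve ℚ) :=
  x3LineDatumThree_of_cert_of_delta _ (by norm_num [Δ, b₂, b₄, b₆, b₈]) 57 98 19
    (by simp only [Ψ₃, eval_add, eval_mul, eval_pow, eval_C, eval_X, eval_ofNat]; norm_num [b₂, b₄, b₆, b₈])
    (X2.CellACertN9.squarefree_of_nodup_primeFactorsList_natAbs (by norm_num) (by simp [Nat.primeFactorsList_ofNat])) (by norm_num)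
    (by rw [KernelDisc.eval_Ψ₂Sq]; norm_num [b₂, b₄, b₆]) (by decide) (by decide) (by decide)

/-- `364140bt2` = `[0,0,0,-1722117,4889774549]` (class `364140bt`, (G-ord, `e = 2`) at `3`; twist `40460c2`, `a₃(V) = 2`, non-anomalous; even line
`φ = χ_{17}`): `x₀ = 51`, `D = 17`, `s = 33614`, `Ψ₂Sq(x₀) = 19208316932` ⇒ `X3LineDatumThree W`. [folklore] -/
theorem x3LineDatumThree_364140bt2 : X3LineDatumThree (⟨0, 0, 0, -1722117, 4889774549⟩ : WeierstrassCurve ℚ) :=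
  x3LineDatumThree_of_cert_of_delta _ (by norm_num [Δ, b₂, b₄, b₆, b₈]) 51 33614 17
    (by simp only [Ψ₃, eval_add, eval_mul, eval_pow, eval_C, eval_X, eval_ofNat]; norm_num [b₂, b₄, b₆, b₈])
    (X2.CellACertN9.squarefree_of_nodup_primeFactorsList_natAbs (by norm_num) (by simp [Nat.primeFactorsList_ofNat])) (by norm_num)
    (by rw [KernelDisc.eval_Ψ₂Sq]; norm_num [b₂, b₄, b₆]) (by decide) (by decide) (by decide)

/-- `364140bz2` = `[0,0,0,-2094672,1166876804]` (class `364140bz`, (G-ord, `e = 2`) at `3`; twist `40460b2`, `a₃(V) = -1`, non-anomalous; even line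
`φ = χ_{17}`): `x₀ = 816`, `D = 17`, `s = 476`, `Ψ₂Sq(x₀) = 3851792` ⇒ `X3LineDatumThree W`. [folklore] -/
theorem x3LineDatumThree_364140bz2 : X3LineDatumThree (⟨0, 0, 0, -2094672, 1166876804⟩ : WeierstrassCurve ℚ) :=
  x3LineDatumThree_of_cert_of_delta _ (by norm_num [Δ, b₂, b₄, b₆, b₈]) 816 476 17
    (by simp only [Ψ₃, eval_add, eval_mul, eval_pow, eval_C, eval_X, eval_ofNat]; norm_num [b₂, b₄, b₆, b₈])
    (X2.CellACertN9.squarefree_of_nodup_primeFactorsList_natAbs (by norm_num) (by simp [Nat.primeFactorsList_ofNat])) (by norm_num)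
    (by rw [KernelDisc.eval_Ψ₂Sq]; norm_num [b₂, b₄, b₆]) (by decide) (by decide) (by decide)

/-- `364140cd2` = `[0,0,0,-950232,463649636]` (class `364140cd`, (G-ord, `e = 2`) at `3`; twist `40460d2`, `a₃(V) = 2`, non-anomalous; even line
`φ = χ_{17}`): `x₀ = 204`, `D = 17`, `s = 8092`, `Ψ₂Sq(x₀) = 1113167888` ⇒ `X3LineDatumThree W`. [folklore] -/
theorem x3LineDatumThree_364140cd2 : X3LineDatumThree (⟨0, 0, 0, -950232, 463649636⟩ : WeierstrassCurve ℚ) :=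
  x3LineDatumThree_of_cert_of_delta _ (by norm_num [Δ, b₂, b₄, b₆, b₈]) 204 8092 17
    (by simp only [Ψ₃, eval_add, eval_mul, eval_pow, eval_C, eval_X, eval_ofNat]; norm_num [b₂, b₄, b₆, b₈])
    (X2.CellACertN9.squarefree_of_nodup_primeFactorsList_natAbs (by norm_num) (by simp [Nat.primeFactorsList_ofNat])) (by norm_num)
    (by rw [KernelDisc.eval_Ψ₂Sq]; norm_num [b₂, b₄, b₆]) (by decide) (by decide) (by decide)

/-- `365760ck2` = `[0,0,0,-1632,41834]` (class `365760ck`, (G-ord, `e = 2`) at `3`; twist `40640c2`, `a₃(V) = -1`, non-anomalous; even line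
`φ = χ_{2}`): `x₀ = 6`, `D = 2`, `s = 254`, `Ψ₂Sq(x₀) = 129032` ⇒ `X3LineDatumThree W`. [folklore] -/
theorem x3LineDatumThree_365760ck2 : X3LineDatumThree (⟨0, 0, 0, -1632, 41834⟩ : WeierstrassCurve ℚ) :=
  x3LineDatumThree_of_cert_of_delta _ (by norm_num [Δ, b₂, b₄, b₆, b₈]) 6 254 2
    (by simp only [Ψ₃, eval_add, eval_mul, eval_pow, eval_C, eval_X, eval_ofNat]; norm_num [b₂, b₄, b₆, b₈])
    Int.prime_two.squarefree (by norm_num)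
    (by rw [KernelDisc.eval_Ψ₂Sq]; norm_num [b₂, b₄, b₆]) (by decide) (by decide) (by decide)

/-- `366075m2` = `[0,0,1,-648750,-333805469]` (class `366075m`, (G-ord, `e = 2`) at `3`; twist `40675a2`, `a₃(V) = 2`, non-anomalous; even line
`φ = χ_{5}`): `x₀ = 1500`, `D = 5`, `s = 40675`, `Ψ₂Sq(x₀) = 8272278125` ⇒ `X3LineDatumThree W`. [folklore] -/
theorem x3LineDatumThree_366075m2 : X3LineDatumThree (⟨0, 0, 1, -648750, -333805469⟩ : WeierstrassCurve ℚ) :=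
  x3LineDatumThree_of_cert_of_delta _ (by norm_num [Δ, b₂, b₄, b₆, b₈]) 1500 40675 5
    (by simp only [Ψ₃, eval_add, eval_mul, eval_pow, eval_C, eval_X, eval_ofNat]; norm_num [b₂, b₄, b₆, b₈])
    (X2.CellACertN9.squarefree_of_nodup_primeFactorsList_natAbs (by norm_num) (by simp [Nat.primeFactorsList_ofNat])) (by norm_num)
    (by rw [KernelDisc.eval_Ψ₂Sq]; norm_num [b₂, b₄, b₆]) (by decide) (by decide) (by decide)

/-- `369342c2` = `[1,-1,0,2491704,-11787872]` (class `369342c`, (G-ord, `e = 2`) at `3`; twist `41038o2`, `a₃(V) = -1`, non-anomalous; even line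
`φ = χ_{17}`): `x₀ = 625`, `D = 17`, `s = 20519`, `Ψ₂Sq(x₀) = 7157499137` ⇒ `X3LineDatumThree W`. [folklore] -/
theorem x3LineDatumThree_369342c2 : X3LineDatumThree (⟨1, -1, 0, 2491704, -11787872⟩ : WeierstrassCurve ℚ) :=
  x3LineDatumThree_of_cert_of_delta _ (by norm_num [Δ, b₂, b₄, b₆, b₈]) 625 20519 17
    (by simp only [Ψ₃, eval_add, eval_mul, eval_pow, eval_C, eval_X, eval_ofNat]; norm_num [b₂, b₄, b₆, b₈])
    (X2.CellACertN9.squarefree_of_nodup_primeFactorsList_natAbs (by norm_num) (by simp [Nat.primeFactorsList_ofNat])) (by norm_num)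
    (by rw [KernelDisc.eval_Ψ₂Sq]; norm_num [b₂, b₄, b₆]) (by decide) (by decide) (by decide)

/-- `369342p2` = `[1,-1,0,1323,2155]` (class `369342p`, (G-ord, `e = 2`) at `3`; twist `41038p2`, `a₃(V) = 2`, non-anomalous; even line
`φ = χ_{17}`): `x₀ = 13`, `D = 17`, `s = 71`, `Ψ₂Sq(x₀) = 85697` ⇒ `X3LineDatumThree W`. [folklore] -/
theorem x3LineDatumThree_369342p2 : X3LineDatumThree (⟨1, -1, 0, 1323, 2155⟩ : WeierstrassCurve ℚ) :=
  x3LineDatumThree_of_cert_of_delta _ (by norm_num [Δ, b₂, b₄, b₆, b₈]) 13 71 17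
    (by simp only [Ψ₃, eval_add, eval_mul, eval_pow, eval_C, eval_X, eval_ofNat]; norm_num [b₂, b₄, b₆, b₈])
    (X2.CellACertN9.squarefree_of_nodup_primeFactorsList_natAbs (by norm_num) (by simp [Nat.primeFactorsList_ofNat])) (by norm_num)
    (by rw [KernelDisc.eval_Ψ₂Sq]; norm_num [b₂, b₄, b₆]) (by decide) (by decide) (by decide)

/-- `369342u2` = `[1,-1,0,-150912,21947098]` (class `369342u`, (G-ord, `e = 2`) at `3`; twist `41038m2`, `a₃(V) = -1`, non-anomalous; even line
`φ = χ_{17}`): `x₀ = 319`, `D = 17`, `s = 1207`, `Ψ₂Sq(x₀) = 24766433` ⇒ `X3LineDatumThree W`. [folklore] -/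
theorem x3LineDatumThree_369342u2 : X3LineDatumThree (⟨1, -1, 0, -150912, 21947098⟩ : WeierstrassCurve ℚ) :=
  x3LineDatumThree_of_cert_of_delta _ (by norm_num [Δ, b₂, b₄, b₆, b₈]) 319 1207 17
    (by simp only [Ψ₃, eval_add, eval_mul, eval_pow, eval_C, eval_X, eval_ofNat]; norm_num [b₂, b₄, b₆, b₈])
    (X2.CellACertN9.squarefree_of_nodup_primeFactorsList_natAbs (by norm_num) (by simp [Nat.primeFactorsList_ofNat])) (by norm_num)
    (by rw [KernelDisc.eval_Ψ₂Sq]; norm_num [b₂, b₄, b₆]) (by decide) (by decide) (by decide)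

/-- `369450g2` = `[1,-1,0,-20430792,35853111616]` (class `369450g`, (G-ord, `e = 2`) at `3`; twist `41050k2`, `a₃(V) = -1`, non-anomalous; even line
`φ = χ_{5}`): `x₀ = 1984`, `D = 5`, `s = 50000`, `Ψ₂Sq(x₀) = 12500000000` ⇒ `X3LineDatumThree W`. [folklore] -/
theorem x3LineDatumThree_369450g2 : X3LineDatumThree (⟨1, -1, 0, -20430792, 35853111616⟩ : WeierstrassCurve ℚ) :=
  x3LineDatumThree_of_cert_of_delta _ (by norm_num [Δ, b₂, b₄, b₆, b₈]) 1984 50000 5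
    (by simp only [Ψ₃, eval_add, eval_mul, eval_pow, eval_C, eval_X, eval_ofNat]; norm_num [b₂, b₄, b₆, b₈])
    (X2.CellACertN9.squarefree_of_nodup_primeFactorsList_natAbs (by norm_num) (by simp [Nat.primeFactorsList_ofNat])) (by norm_num)
    (by rw [KernelDisc.eval_Ψ₂Sq]; norm_num [b₂, b₄, b₆]) (by decide) (by decide) (by decide)

/-- `370881y2` = `[0,0,1,-29423226,60270810178]` (class `370881y`, (G-ord, `e = 2`) at `3`; twist `41209a2`, `a₃(V) = 2`, non-anomalous; even line
`φ = χ_{29}`): `x₀ = 4263`, `D = 29`, `s = 41209`, `Ψ₂Sq(x₀) = 49247268749` ⇒ `X3LineDatumThree W`. [folklore] -/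
theorem x3LineDatumThree_370881y2 : X3LineDatumThree (⟨0, 0, 1, -29423226, 60270810178⟩ : WeierstrassCurve ℚ) :=
  x3LineDatumThree_of_cert_of_delta _ (by norm_num [Δ, b₂, b₄, b₆, b₈]) 4263 41209 29
    (by simp only [Ψ₃, eval_add, eval_mul, eval_pow, eval_C, eval_X, eval_ofNat]; norm_num [b₂, b₄, b₆, b₈])
    (X2.CellACertN9.squarefree_of_nodup_primeFactorsList_natAbs (by norm_num) (by simp [Nat.primeFactorsList_ofNat])) (by norm_num)
    (by rw [KernelDisc.eval_Ψ₂Sq]; norm_num [b₂, b₄, b₆]) (by decide) (by decide) (by decide)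

/-- `371475ba2` = `[0,0,1,-38143200,-605136530219]` (class `371475ba`, (G-ord, `e = 2`) at `3`; twist `41275a2`, `a₃(V) = 2`, non-anomalous; even line
`φ = χ_{5}`): `x₀ = 15360`, `D = 5`, `s = 1395095`, `Ψ₂Sq(x₀) = 9731450295125` ⇒ `X3LineDatumThree W`. [folklore] -/
theorem x3LineDatumThree_371475ba2 : X3LineDatumThree (⟨0, 0, 1, -38143200, -605136530219⟩ : WeierstrassCurve ℚ) :=
  x3LineDatumThree_of_cert_of_delta _ (by norm_num [Δ, b₂, b₄, b₆, b₈]) 15360 1395095 5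
    (by simp only [Ψ₃, eval_add, eval_mul, eval_pow, eval_C, eval_X, eval_ofNat]; norm_num [b₂, b₄, b₆, b₈])
    (X2.CellACertN9.squarefree_of_nodup_primeFactorsList_natAbs (by norm_num) (by simp [Nat.primeFactorsList_ofNat])) (by norm_num)
    (by rw [KernelDisc.eval_Ψ₂Sq]; norm_num [b₂, b₄, b₆]) (by decide) (by decide) (by decide)

/-- `373050bd2` = `[1,-1,1,-959630,363725997]` (class `373050bd`, (G-ord, `e = 2`) at `3`; twist `41450a2`, `a₃(V) = -1`, non-anomalous; even line
`φ = χ_{5}`): `x₀ = 454`, `D = 5`, `s = 4145`, `Ψ₂Sq(x₀) = 85905125` ⇒ `X3LineDatumThree W`. [folklore] -/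
theorem x3LineDatumThree_373050bd2 : X3LineDatumThree (⟨1, -1, 1, -959630, 363725997⟩ : WeierstrassCurve ℚ) :=
  x3LineDatumThree_of_cert_of_delta _ (by norm_num [Δ, b₂, b₄, b₆, b₈]) 454 4145 5
    (by simp only [Ψ₃, eval_add, eval_mul, eval_pow, eval_C, eval_X, eval_ofNat]; norm_num [b₂, b₄, b₆, b₈])
    (X2.CellACertN9.squarefree_of_nodup_primeFactorsList_natAbs (by norm_num) (by simp [Nat.primeFactorsList_ofNat])) (by norm_num)
    (by rw [KernelDisc.eval_Ψ₂Sq]; norm_num [b₂, b₄, b₆]) (by decide) (by decide) (by decide)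

/-- `374850bq2` = `[1,-1,0,-1332,-1427504]` (class `374850bq`, (G-ord, `e = 2`) at `3`; twist `41650bj2`, `a₃(V) = -1`, non-anomalous; even line
`φ = χ_{5}`): `x₀ = 184`, `D = 5`, `s = 1904`, `Ψ₂Sq(x₀) = 18126080` ⇒ `X3LineDatumThree W`. [folklore] -/
theorem x3LineDatumThree_374850bq2 : X3LineDatumThree (⟨1, -1, 0, -1332, -1427504⟩ : WeierstrassCurve ℚ) :=
  x3LineDatumThree_of_cert_of_delta _ (by norm_num [Δ, b₂, b₄, b₆, b₈]) 184 1904 5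
    (by simp only [Ψ₃, eval_add, eval_mul, eval_pow, eval_C, eval_X, eval_ofNat]; norm_num [b₂, b₄, b₆, b₈])
    (X2.CellACertN9.squarefree_of_nodup_primeFactorsList_natAbs (by norm_num) (by simp [Nat.primeFactorsList_ofNat])) (by norm_num)
    (by rw [KernelDisc.eval_Ψ₂Sq]; norm_num [b₂, b₄, b₆]) (by decide) (by decide) (by decide)

/-- `374850do2` = `[1,-1,0,336033,18701941]` (class `374850do`, (G-ord, `e = 2`) at `3`; twist `41650bl2`, `a₃(V) = 2`, non-anomalous; even line
`φ = χ_{5}`): `x₀ = 184`, `D = 5`, `s = 8330`, `Ψ₂Sq(x₀) = 346944500` ⇒ `X3LineDatumThree W`. [folklore] -/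
theorem x3LineDatumThree_374850do2 : X3LineDatumThree (⟨1, -1, 0, 336033, 18701941⟩ : WeierstrassCurve ℚ) :=
  x3LineDatumThree_of_cert_of_delta _ (by norm_num [Δ, b₂, b₄, b₆, b₈]) 184 8330 5
    (by simp only [Ψ₃, eval_add, eval_mul, eval_pow, eval_C, eval_X, eval_ofNat]; norm_num [b₂, b₄, b₆, b₈])
    (X2.CellACertN9.squarefree_of_nodup_primeFactorsList_natAbs (by norm_num) (by simp [Nat.primeFactorsList_ofNat])) (by norm_num)
    (by rw [KernelDisc.eval_Ψ₂Sq]; norm_num [b₂, b₄, b₆]) (by decide) (by decide) (by decide)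

/-- `374850gc2` = `[1,-1,0,-244077192,1467766489216]` (class `374850gc`, (G-ord, `e = 2`) at `3`; twist `41650bk2`, `a₃(V) = -1`, non-anomalous; even line
`φ = χ_{5}`): `x₀ = 9004`, `D = 5`, `s = 2380`, `Ψ₂Sq(x₀) = 28322000` ⇒ `X3LineDatumThree W`. [folklore] -/
theorem x3LineDatumThree_374850gc2 : X3LineDatumThree (⟨1, -1, 0, -244077192, 1467766489216⟩ : WeierstrassCurve ℚ) :=
  x3LineDatumThree_of_cert_of_delta _ (by norm_num [Δ, b₂, b₄, b₆, b₈]) 9004 2380 5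
    (by simp only [Ψ₃, eval_add, eval_mul, eval_pow, eval_C, eval_X, eval_ofNat]; norm_num [b₂, b₄, b₆, b₈])
    (X2.CellACertN9.squarefree_of_nodup_primeFactorsList_natAbs (by norm_num) (by simp [Nat.primeFactorsList_ofNat])) (by norm_num)
    (by rw [KernelDisc.eval_Ψ₂Sq]; norm_num [b₂, b₄, b₆]) (by decide) (by decide) (by decide)

/-- `377550ba2` = `[1,-1,1,-812930,625529697]` (class `377550ba`, (G-ord, `e = 2`) at `3`; twist `41950a2`, `a₃(V) = 2`, non-anomalous; even line
`φ = χ_{5}`): `x₀ = 94`, `D = 5`, `s = 20975`, `Ψ₂Sq(x₀) = 2199753125` ⇒ `X3LineDatumThree W`. [folklore] -/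
theorem x3LineDatumThree_377550ba2 : X3LineDatumThree (⟨1, -1, 1, -812930, 625529697⟩ : WeierstrassCurve ℚ) :=
  x3LineDatumThree_of_cert_of_delta _ (by norm_num [Δ, b₂, b₄, b₆, b₈]) 94 20975 5
    (by simp only [Ψ₃, eval_add, eval_mul, eval_pow, eval_C, eval_X, eval_ofNat]; norm_num [b₂, b₄, b₆, b₈])
    (X2.CellACertN9.squarefree_of_nodup_primeFactorsList_natAbs (by norm_num) (by simp [Nat.primeFactorsList_ofNat])) (by norm_num)
    (by rw [KernelDisc.eval_Ψ₂Sq]; norm_num [b₂, b₄, b₆]) (by decide) (by decide) (by decide)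

end Summit.BirchSwinnertonDyer.Rank1Residual.Additive.X3ThreeLineDatumRecords
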